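import Mathlib.Algebra.Ring.GeomSum
import Mathlib.Algebra.MonoidAlgebra.Basic
import Mathlib.Tactic.NoncommRing
import Literature.Algebra.Lie.FreeLieAlgebraGrading
import Literature.Algebra.Lie.SurfaceLieAlgebraElimination
import HarnessLib

/-!
# The truncated Magnus algebra of the surface group: weights, truncation, the twist `σ`

Topic `Literature/Algebra/Lie`. Algebraic groundwork for the Magnus-type representation of the
surface group used in the proof of Labute's theorem (`Literature/Algebra/Lie/SurfaceGroupMagnus.lean`,
`Literature.Algebra.Lie.Labute1970_grSurfaceGroup`). Let `Y = EGen g` be the elimination alphabet of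
`𝔰_{g+1}` (`a₀` and `ad(b₀)^k a_{j+1}`, `ad(b₀)^k b_{j+1}`, weights `1`, `k+1`;
`Literature/Algebra/Lie/SurfaceLieAlgebraElimination.lean`) and `𝒯 = ℤ[FreeMonoid Y]` the free
associative ring on it, graded by weight (`Literature.Algebra.Lie.tensorGrade`). This file provides:

* the weight filtration `geW g n` (`= combinations of words of weight ≥ n`), multiplicative
  (`mul_mem_geW`), and the light part `light g N` (weight `≤ N`);
* the **truncation** `trunc g N : 𝒯 → 𝒯` (discard words of weight `> N`) and its calculus
  (`trunc_mul_trunc`, `sub_trunc_mem_geW`, …); the truncated module `M g N = light g N` with the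
  **left-regular truncated action** `Lop g N : 𝒯 →+* End_ℤ(M)`, `u ↦ (x ↦ trunc (u x))`, faithful on
  light elements (`eq_zero_of_Lop_eq_zero`);
* the truncated inverse `invT N x = ∑_{m ≤ N} (-x)^m` of `1 + x`;
* the **twisting endomorphism** `σT g N : 𝒯 →ₐ[ℤ] 𝒯` (Magnus image of conjugation by `b₀`):
  `e_{j,ε,k} ↦ e_{j,ε,k} + e_{j,ε,k+1}` and `a₀ ↦ w (1 + a₀) - 1` where
  `w = ∏ⱼ (1+e_{aⱼ})(1+e_{bⱼ})(1+e_{aⱼ})⁻¹(1+e_{bⱼ})⁻¹` (truncated inverses, `wEl`), with its weight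
  behaviour: `σT` preserves `geW n` (`σT_mem_geW`) and `σT u - u ∈ geW (n+1)` for `u` of weight `n`
  (`σT_sub_self_mem_geW`);
* the induced operator `Sig g N ∈ End_ℤ(M)` and the **semilinearity**
  `Sig ∘ Lop u = Lop (σT u) ∘ Sig` (`Sig_mul_Lop`).

Everything here is elementary and fully proved; there are no named facts.

## References

* W. Magnus, A. Karrass, D. Solitar, *Combinatorial Group Theory*, §5.5 (Magnus' power series ring,
  truncations).
* J. P. Labute, J. Algebra 14 (1970) 16–23, §3. [Labute1970]
-/

noncomputable section

namespace Literature.Algebra.Lie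

namespace SurfaceMagnus

open SurfaceElim MonoidAlgebra

variable (g N : ℕ)

/-- `𝒯 = ℤ[FreeMonoid (EGen g)]`, the free associative ring on the elimination alphabet. [folklore] -/
abbrev T : Type := MonoidAlgebra ℤ (FreeMonoid (EGen g))

/-- The weight of a word in the elimination alphabet. [folklore] -/
abbrev ω (w : FreeMonoid (EGen g)) : ℕ := (wordWeight (wtE g) w).toAdd

/-- The letter `e_y ∈ 𝒯` of an elimination generator `y`. [folklore] -/
def e (y : EGen g) : T g := MonoidAlgebra.single (FreeMonoid.of y) 1

/-! ## The weight filtration and truncation -/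

/-- `geW n`: combinations of words of weight `≥ n`. [folklore] -/
def geW (n : ℕ) : Submodule ℤ (T g) := MonoidAlgebra.supported ℤ ℤ {w | n ≤ ω g w}

/-- `light N`: combinations of words of weight `≤ N`. [folklore] -/
def light : Submodule ℤ (T g) := MonoidAlgebra.supported ℤ ℤ {w | ω g w ≤ N}

variable {g N}

/-- Membership in `geW n` via coefficients. [folklore] -/
theorem mem_geW_iff {n : ℕ} {a : T g} : a ∈ geW g n ↔ ∀ w, a.coeff w ≠ 0 → n ≤ ω g w := by
  unfold geW; rw [MonoidAlgebra.mem_supported]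
  exact ⟨fun h w hw => h (Finsupp.mem_support_iff.2 hw), fun h w hw => h w (Finsupp.mem_support_iff.1 hw)⟩

/-- Membership in `light N` via coefficients. [folklore] -/
theorem mem_light_iff {a : T g} : a ∈ light g N ↔ ∀ w, a.coeff w ≠ 0 → ω g w ≤ N := by
  unfold light; rw [MonoidAlgebra.mem_supported]
  exact ⟨fun h w hw => h (Finsupp.mem_support_iff.2 hw), fun h w hw => h w (Finsupp.mem_support_iff.1 hw)⟩

/-- `geW` decreases. [folklore] -/
theorem geW_antitone {m n : ℕ} (h : m ≤ n) : geW g n ≤ geW g m :=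
  fun _ ha => mem_geW_iff.2 fun w hw => h.trans (mem_geW_iff.1 ha w hw)

/-- Everything has weight `≥ 0`. [folklore] -/
theorem mem_geW_zero (a : T g) : a ∈ geW g 0 := mem_geW_iff.2 fun _ _ => Nat.zero_le _

/-- A word of weight `≥ n` lies in `geW n`. [folklore] -/
theorem single_mem_geW {n : ℕ} {w : FreeMonoid (EGen g)} (hw : n ≤ ω g w) (c : ℤ) : single w c ∈ geW g n := by
  refine mem_geW_iff.2 fun w' hw' => ?_
  rw [MonoidAlgebra.coeff_single] at hw'
  rw [Finset.mem_singleton.1 (Finsupp.support_single_subset (Finsupp.mem_support_iff.2 hw'))]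
  exact hw

/-- The letter `e_y` has weight `wt y`. [folklore] -/
theorem e_mem_geW (y : EGen g) : e g y ∈ geW g (wtE g y) := single_mem_geW (by simp [ω]) 1

/-- The letter `a₀` has weight `1`. [folklore] -/
theorem e_none_mem_geW : e g none ∈ geW g 1 := e_mem_geW (g := g) none

/-- The letter `e_{j,ε,k}` has weight `k + 1`. [folklore] -/
theorem e_some_mem_geW (j : Fin g) (ε : Bool) (k : ℕ) : e g (some (j, ε, k)) ∈ geW g (k + 1) :=
  e_mem_geW (g := g) (some (j, ε, k))

/-- The letter `e_y` is homogeneous of weight `wt y`. [folklore] -/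
theorem e_mem_tensorGrade (y : EGen g) : e g y ∈ tensorGrade ℤ (wtE g) (wtE g y) :=
  single_of_mem_tensorGrade (wtE g) y 1

/-- Pure weight `n` implies weight `≥ n`. [folklore] -/
theorem tensorGrade_le_geW (n : ℕ) : tensorGrade ℤ (wtE g) n ≤ geW g n :=
  fun _ ha => mem_geW_iff.2 fun w hw => le_of_eq (((mem_tensorGrade_iff.1 ha) w (Finsupp.mem_support_iff.2 hw)).symm)

/-- Pure weight `n ≤ N` implies light. [folklore] -/
theorem tensorGrade_le_light {n : ℕ} (hn : n ≤ N) : tensorGrade ℤ (wtE g) n ≤ light g N :=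
  fun _ ha => mem_light_iff.2 fun w hw => (le_of_eq ((mem_tensorGrade_iff.1 ha) w (Finsupp.mem_support_iff.2 hw))).trans hn

/-- **Multiplicativity of the weight filtration**: `geW m · geW n ⊆ geW (m+n)`. [folklore] -/
theorem mul_mem_geW {m n : ℕ} {a b : T g} (ha : a ∈ geW g m) (hb : b ∈ geW g n) : a * b ∈ geW g (m + n) := by
  classical
  unfold geW at ha hb ⊢
  rw [MonoidAlgebra.mem_supported] at ha hb ⊢
  intro w hw
  obtain ⟨u, hu, v, hv, rfl⟩ := Finset.mem_mul.1 (MonoidAlgebra.support_coeff_mul_subset a b hw)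
  change m + n ≤ ω g (u * v)
  simp only [ω, map_mul, toAdd_mul]
  exact Nat.add_le_add (ha hu) (hb hv)

/-- Powers climb the filtration: `a ∈ geW 1 ⟹ aᵐ ∈ geW m`. [folklore] -/
theorem pow_mem_geW {a : T g} (ha : a ∈ geW g 1) (m : ℕ) : a ^ m ∈ geW g m := by
  induction m with
  | zero => rw [pow_zero]; exact mem_geW_zero _
  | succ m ih => rw [pow_succ]; exact mul_mem_geW ih ha

variable (g N)

open Classical in
/-- The **truncation** at weight `N`: keep the words of weight `≤ N`. [folklore] -/
def trunc : T g →ₗ[ℤ] T g :=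
  (MonoidAlgebra.coeffLinearEquiv ℤ).symm.toLinearMap ∘ₗ
    finsuppFilterLinear (fun w => ω g w ≤ N) ∘ₗ (MonoidAlgebra.coeffLinearEquiv ℤ).toLinearMap

variable {g N}

open Classical in
/-- Coefficients of the truncation. [folklore] -/
theorem coeff_trunc (a : T g) (w : FreeMonoid (EGen g)) :
    (trunc g N a).coeff w = if ω g w ≤ N then a.coeff w else 0 := by
  simp [trunc, Finsupp.filter_apply]

/-- The truncation is light. [folklore] -/
theorem trunc_mem_light (a : T g) : trunc g N a ∈ light g N := by
  refine mem_light_iff.2 fun w hw => ?_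
  rw [coeff_trunc] at hw
  by_contra h; exact hw (if_neg h)

/-- Light elements are their own truncation. [folklore] -/
theorem trunc_of_mem_light {a : T g} (ha : a ∈ light g N) : trunc g N a = a := by
  refine MonoidAlgebra.coeff_injective (Finsupp.ext fun w => ?_)
  rw [coeff_trunc]
  split_ifs with h
  · rfl
  · by_contra hne; exact h (mem_light_iff.1 ha w (Ne.symm hne))

/-- Heavy elements (weight `> N`) truncate to zero. [folklore] -/
theorem trunc_of_mem_geW_succ {a : T g} (ha : a ∈ geW g (N + 1)) : trunc g N a = 0 := by
  refine MonoidAlgebra.coeff_injective (Finsupp.ext fun w => ?_)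
  rw [coeff_trunc, MonoidAlgebra.coeff_zero, Finsupp.zero_apply]
  split_ifs with h
  · by_contra hne
    have := mem_geW_iff.1 ha w hne
    omega
  · rfl

/-- `a - trunc a` is heavy. [folklore] -/
theorem sub_trunc_mem_geW (a : T g) : a - trunc g N a ∈ geW g (N + 1) := by
  refine mem_geW_iff.2 fun w hw => ?_
  rw [MonoidAlgebra.coeff_sub, Finsupp.sub_apply, coeff_trunc] at hw
  by_contra h
  rw [if_pos (by omega), sub_self] at hw
  exact hw rfl

/-- Truncation does not lower weights: `a ∈ geW n ⟹ trunc a ∈ geW n`. [folklore] -/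
theorem trunc_mem_geW {n : ℕ} {a : T g} (ha : a ∈ geW g n) : trunc g N a ∈ geW g n := by
  refine mem_geW_iff.2 fun w hw => ?_
  rw [coeff_trunc] at hw
  split_ifs at hw with h
  · exact mem_geW_iff.1 ha w hw
  · exact absurd rfl hw

/-- Truncation preserves pure weight. [folklore] -/
theorem trunc_mem_tensorGrade {n : ℕ} {a : T g} (ha : a ∈ tensorGrade ℤ (wtE g) n) :
    trunc g N a ∈ tensorGrade ℤ (wtE g) n := by
  rw [mem_tensorGrade_iff] at ha ⊢
  intro w hw
  rw [Finsupp.mem_support_iff, coeff_trunc] at hw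
  split_ifs at hw with h
  · exact ha w (Finsupp.mem_support_iff.2 hw)
  · exact absurd rfl hw

/-- `1` is light. [folklore] -/
theorem one_mem_light : (1 : T g) ∈ light g N := by
  rw [MonoidAlgebra.one_def]
  refine mem_light_iff.2 fun w hw => ?_
  rw [MonoidAlgebra.coeff_single] at hw
  rw [Finset.mem_singleton.1 (Finsupp.support_single_subset (Finsupp.mem_support_iff.2 hw))]
  simp [ω]

/-- Truncating a product after truncating a factor: `trunc (a · trunc b) = trunc (a b)`. [folklore] -/
theorem trunc_mul_trunc (a b : T g) : trunc g N (a * trunc g N b) = trunc g N (a * b) := by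
  have h : a * b = a * trunc g N b + a * (b - trunc g N b) := by rw [← mul_add, add_sub_cancel]
  rw [h, map_add, trunc_of_mem_geW_succ (N := N) (a := a * (b - trunc g N b)), add_zero]
  have := mul_mem_geW (mem_geW_zero a) (sub_trunc_mem_geW (N := N) b)
  rwa [zero_add] at this

/-- `trunc (trunc a · b) = trunc (a b)`. [folklore] -/
theorem trunc_trunc_mul (a b : T g) : trunc g N (trunc g N a * b) = trunc g N (a * b) := by
  have h : a * b = trunc g N a * b + (a - trunc g N a) * b := by rw [← add_mul, add_sub_cancel]
  rw [h, map_add, trunc_of_mem_geW_succ (N := N) (a := (a - trunc g N a) * b), add_zero]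
  have := mul_mem_geW (sub_trunc_mem_geW (N := N) a) (mem_geW_zero b)
  rwa [add_zero] at this

/-- Truncation ignores heavy summands. [folklore] -/
theorem trunc_add_of_mem_geW_succ (a : T g) {h : T g} (hh : h ∈ geW g (N + 1)) : trunc g N (a + h) = trunc g N a := by
  rw [map_add, trunc_of_mem_geW_succ hh, add_zero]

/-! ## The truncated module `M = light N` and the action `Lop` -/

variable (g N)

/-- The truncated module `M = 𝒯_{≤ N}` (light elements). [folklore] -/
abbrev M : Type := ↥(light g N)

/-- Truncation as a map into `M`. [folklore] -/
def truncM : T g →ₗ[ℤ] M g N := LinearMap.codRestrict (light g N) (trunc g N) trunc_mem_light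

/-- `truncM` computes `trunc`. [folklore] -/
@[simp] theorem coe_truncM (a : T g) : (truncM g N a : T g) = trunc g N a := rfl

/-- The **truncated left multiplication** `Lop u : x ↦ trunc (u x)` on `M`. [folklore] -/
def LopLin (u : T g) : Module.End ℤ (M g N) :=
  truncM g N ∘ₗ LinearMap.mulLeft ℤ u ∘ₗ (light g N).subtype

/-- `Lop u x = trunc (u x)`. [folklore] -/
@[simp] theorem coe_LopLin (u : T g) (x : M g N) : (LopLin g N u x : T g) = trunc g N (u * x) := rfl

/-- **`Lop` is a ring morphism `𝒯 → End_ℤ(M)`** (the truncated left-regular representation).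
[folklore] -/
def Lop : T g →+* Module.End ℤ (M g N) where
  toFun := LopLin g N
  map_one' := by
    refine LinearMap.ext fun x => Subtype.ext ?_
    rw [coe_LopLin, one_mul, Module.End.one_apply, trunc_of_mem_light x.2]
  map_mul' u v := by
    refine LinearMap.ext fun x => Subtype.ext ?_
    rw [coe_LopLin, Module.End.mul_apply, coe_LopLin, coe_LopLin, trunc_mul_trunc, mul_assoc]
  map_zero' := by
    refine LinearMap.ext fun x => Subtype.ext ?_
    rw [coe_LopLin, zero_mul, map_zero, LinearMap.zero_apply]; rfl
  map_add' u v := by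
    refine LinearMap.ext fun x => Subtype.ext ?_
    rw [coe_LopLin, add_mul, map_add, LinearMap.add_apply, Submodule.coe_add, coe_LopLin, coe_LopLin]

variable {g N}

/-- `Lop u x = trunc (u x)`. [folklore] -/
@[simp] theorem coe_Lop (u : T g) (x : M g N) : (Lop g N u x : T g) = trunc g N (u * x) := rfl

/-- The unit vector `1 ∈ M`. [folklore] -/
def oneM : M g N := ⟨1, one_mem_light⟩

/-- `Lop u 1 = trunc u`. [folklore] -/
theorem coe_Lop_oneM (u : T g) : (Lop g N u (oneM : M g N) : T g) = trunc g N u := by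
  rw [coe_Lop]; change trunc g N (u * 1) = _; rw [mul_one]

/-- Heavy elements act by zero. [folklore] -/
theorem Lop_eq_zero_of_mem_geW_succ {u : T g} (hu : u ∈ geW g (N + 1)) : Lop g N u = 0 := by
  refine LinearMap.ext fun x => Subtype.ext ?_
  rw [coe_Lop, LinearMap.zero_apply]
  have := mul_mem_geW hu (mem_geW_zero (x : T g))
  rw [add_zero] at this
  exact trunc_of_mem_geW_succ this

/-- **Faithfulness on light elements**: a light `u` acting by zero is zero. [folklore] -/
theorem eq_zero_of_Lop_eq_zero {u : T g} (hu : u ∈ light g N) (h : Lop g N u = 0) : u = 0 := by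
  have := coe_Lop_oneM (N := N) u
  rw [h, LinearMap.zero_apply, trunc_of_mem_light hu] at this
  exact this.symm

/-! ## Truncated inverses and the twist `σ` -/

variable (N)

/-- The truncated inverse `∑_{m ≤ N+1} (-x)^m` of `1 + x` (one more term than strictly needed, so that
`invT x ≡ 1 - x` modulo weight `≥ 2` for every `N`). [folklore] -/
def invT (x : T g) : T g := ∑ m ∈ Finset.range (N + 2), (-x) ^ m

variable {N}

/-- `(1 + x) · invT x = 1 - (-x)^{N+2}`. [folklore] -/
theorem one_add_mul_invT (x : T g) : (1 + x) * invT N x = 1 - (-x) ^ (N + 2) := by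
  have := mul_neg_geom_sum (-x) (N + 2)
  rwa [sub_neg_eq_add] at this

/-- `invT x · (1 + x) = 1 - (-x)^{N+2}`. [folklore] -/
theorem invT_mul_one_add (x : T g) : invT N x * (1 + x) = 1 - (-x) ^ (N + 2) := by
  have := geom_sum_mul_neg (-x) (N + 2)
  rwa [sub_neg_eq_add] at this

/-- For `x` of weight `≥ 1` the error term `(-x)^{N+2}` has weight `≥ N + 2`. [folklore] -/
theorem neg_pow_mem_geW {x : T g} (hx : x ∈ geW g 1) : (-x) ^ (N + 2) ∈ geW g (N + 2) :=
  pow_mem_geW (Submodule.neg_mem _ hx) (N + 2)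

/-- `1 - (1 + x) · invT x` is heavy. [folklore] -/
theorem one_sub_one_add_mul_invT_mem {x : T g} (hx : x ∈ geW g 1) : 1 - (1 + x) * invT N x ∈ geW g (N + 2) := by
  rw [one_add_mul_invT, sub_sub_cancel]; exact neg_pow_mem_geW hx

/-- `1 - invT x · (1 + x)` is heavy. [folklore] -/
theorem one_sub_invT_mul_one_add_mem {x : T g} (hx : x ∈ geW g 1) : 1 - invT N x * (1 + x) ∈ geW g (N + 2) := by
  rw [invT_mul_one_add, sub_sub_cancel]; exact neg_pow_mem_geW hx

/-- In the truncated action, `invT x` is a right inverse of `1 + x`. [folklore] -/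
theorem Lop_one_add_mul_Lop_invT {x : T g} (hx : x ∈ geW g 1) : Lop g N (1 + x) * Lop g N (invT N x) = 1 := by
  rw [← map_mul, one_add_mul_invT, map_sub, map_one, Lop_eq_zero_of_mem_geW_succ, sub_zero]
  exact geW_antitone (Nat.le_succ _) (neg_pow_mem_geW hx)

/-- In the truncated action, `invT x` is a left inverse of `1 + x`. [folklore] -/
theorem Lop_invT_mul_Lop_one_add {x : T g} (hx : x ∈ geW g 1) : Lop g N (invT N x) * Lop g N (1 + x) = 1 := by
  rw [← map_mul, invT_mul_one_add, map_sub, map_one, Lop_eq_zero_of_mem_geW_succ, sub_zero]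
  exact geW_antitone (Nat.le_succ _) (neg_pow_mem_geW hx)

/-- `invT x - 1` has weight `≥ 1` when `x` does. [folklore] -/
theorem invT_sub_one_mem_geW {x : T g} (hx : x ∈ geW g 1) : invT N x - 1 ∈ geW g 1 := by
  unfold invT
  rw [Finset.sum_range_succ', pow_zero, add_sub_cancel_right]
  refine Submodule.sum_mem _ fun m _ => ?_
  exact geW_antitone (by omega) (pow_mem_geW (Submodule.neg_mem _ hx) (m + 1))

/-- Elements congruent to `1` modulo `geW n` are closed under products. [folklore] -/
theorem mul_sub_one_mem_geW {n : ℕ} {a b : T g} (ha : a - 1 ∈ geW g n) (hb : b - 1 ∈ geW g n) :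
    a * b - 1 ∈ geW g n := by
  have : a * b - 1 = (a - 1) + (b - 1) + (a - 1) * (b - 1) := by noncomm_ring
  rw [this]
  exact add_mem (add_mem ha hb) (geW_antitone (by omega) (mul_mem_geW ha hb))

/-- A list product of elements congruent to `1` modulo `geW n` is congruent to `1`. [folklore] -/
theorem list_prod_sub_one_mem_geW {n : ℕ} (l : List (T g)) (hl : ∀ a ∈ l, a - 1 ∈ geW g n) :
    l.prod - 1 ∈ geW g n := by
  induction l with
  | nil => simp
  | cons a l ih =>
    rw [List.prod_cons]
    exact mul_sub_one_mem_geW (hl a (by simp)) (ih fun b hb => hl b (by simp [hb]))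

variable (g N)

/-- The truncated group commutator `Cⱼ = (1+e_{aⱼ})(1+e_{bⱼ})(1+e_{aⱼ})⁻¹(1+e_{bⱼ})⁻¹` of the letters of the
`j`-th non-distinguished pair (`aⱼ ↔ (j,false,0)`, `bⱼ ↔ (j,true,0)`). [folklore] -/
def Cfac (j : Fin g) : T g :=
  (1 + e g (some (j, false, 0))) * (1 + e g (some (j, true, 0))) *
    invT N (e g (some (j, false, 0))) * invT N (e g (some (j, true, 0)))

/-- `w = ∏ⱼ Cⱼ` (ordered product), the Magnus image of `∏_{j ≥ 1} ⁅aⱼ, bⱼ⁆`. [folklore] -/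
def wEl : T g := ((List.finRange g).map (Cfac g N)).prod

/-- The values of the twist on letters: `e_{j,ε,k} ↦ e_{j,ε,k} + e_{j,ε,k+1}`, `a₀ ↦ w(1 + a₀) - 1`.
[folklore] -/
def σgen : EGen g → T g
  | none => wEl g N * (1 + e g none) - 1
  | some (j, ε, k) => e g (some (j, ε, k)) + e g (some (j, ε, k + 1))

/-- **The twist `σ : 𝒯 → 𝒯`**, the ring endomorphism extending `σgen` (Magnus image of
conjugation by `b₀` in the surface group). [folklore] -/
def σT : T g →ₐ[ℤ] T g := MonoidAlgebra.lift ℤ (T g) (FreeMonoid (EGen g)) (FreeMonoid.lift (σgen g N))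

variable {g N}

/-- `σgen` at `a₀`. [folklore] -/
@[simp] theorem σgen_none : σgen g N none = wEl g N * (1 + e g none) - 1 := rfl

/-- `σgen` at `e_{j,ε,k}`. [folklore] -/
@[simp] theorem σgen_some (j : Fin g) (ε : Bool) (k : ℕ) :
    σgen g N (some (j, ε, k)) = e g (some (j, ε, k)) + e g (some (j, ε, k + 1)) := rfl

/-- `σ` on a word with coefficient. [folklore] -/
theorem σT_single (w : FreeMonoid (EGen g)) (c : ℤ) : σT g N (single w c) = c • FreeMonoid.lift (σgen g N) w := by
  rw [σT, MonoidAlgebra.lift_single]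

/-- `σ` on letters. [folklore] -/
@[simp] theorem σT_e (y : EGen g) : σT g N (e g y) = σgen g N y := by
  rw [e, σT_single, one_smul, FreeMonoid.lift_eval_of]

/-- `σ (1 + a₀) = w (1 + a₀)`: the defining property of the twist at the distinguished letter.
[folklore] -/
theorem σT_one_add_e_none : σT g N (1 + e g none) = wEl g N * (1 + e g none) := by
  rw [map_add, map_one, σT_e, σgen_none, add_sub_cancel]

/-- `Cⱼ ≡ 1` modulo weight `≥ 2`. [folklore] -/
theorem Cfac_sub_one_mem (j : Fin g) : Cfac g N j - 1 ∈ geW g 2 := by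
  set A := e g (some (j, false, 0)) with hA
  set B := e g (some (j, true, 0)) with hB
  have hA1 : A ∈ geW g 1 := e_some_mem_geW j false 0
  have hB1 : B ∈ geW g 1 := e_some_mem_geW j true 0
  have key : Cfac g N j - 1 = -(1 - (1 + B) * invT N B) - (1 + B) * (1 - (1 + A) * invT N A) * invT N B +
      (A * B - B * A) * invT N A * invT N B := by
    unfold Cfac; noncomm_ring
  rw [key]
  have h2 : 2 ≤ N + 2 := by omega
  refine add_mem (sub_mem (Submodule.neg_mem _ (geW_antitone h2 (one_sub_one_add_mul_invT_mem hB1))) ?_) ?_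
  · have := mul_mem_geW (mul_mem_geW (mem_geW_zero (1 + B)) (one_sub_one_add_mul_invT_mem (N := N) hA1))
      (mem_geW_zero (invT N B))
    rw [zero_add, add_zero] at this
    exact geW_antitone h2 this
  · have hAB : A * B - B * A ∈ geW g 2 := sub_mem (mul_mem_geW hA1 hB1) (mul_mem_geW hB1 hA1)
    have := mul_mem_geW (mul_mem_geW hAB (mem_geW_zero (invT N A))) (mem_geW_zero (invT N B))
    rwa [add_zero, add_zero] at this

/-- `w ≡ 1` modulo weight `≥ 2`. [folklore] -/
theorem wEl_sub_one_mem : wEl g N - 1 ∈ geW g 2 := by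
  unfold wEl
  refine list_prod_sub_one_mem_geW _ fun a ha => ?_
  obtain ⟨j, -, rfl⟩ := List.mem_map.1 ha
  exact Cfac_sub_one_mem j

/-- `σgen y - e_y ∈ geW (wt y + 1)`: the twist is the identity to first order. [folklore] -/
theorem σgen_sub_e_mem_geW (y : EGen g) : σgen g N y - e g y ∈ geW g (wtE g y + 1) := by
  rcases y with _ | ⟨j, ε, k⟩
  · change wEl g N * (1 + e g none) - 1 - e g none ∈ geW g 2
    have : wEl g N * (1 + e g none) - 1 - e g none = (wEl g N - 1) * (1 + e g none) := by noncomm_ring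
    rw [this]
    have := mul_mem_geW (wEl_sub_one_mem (N := N)) (mem_geW_zero (1 + e g none) (g := g))
    rwa [add_zero] at this
  · change e g (some (j, ε, k)) + e g (some (j, ε, k + 1)) - e g (some (j, ε, k)) ∈ geW g (k + 1 + 1)
    rw [add_sub_cancel_left]
    exact e_some_mem_geW j ε (k + 1)

/-- `σgen y ∈ geW (wt y)`. [folklore] -/
theorem σgen_mem_geW (y : EGen g) : σgen g N y ∈ geW g (wtE g y) := by
  have : σgen g N y = (σgen g N y - e g y) + e g y := by abel
  rw [this]
  exact add_mem (geW_antitone (Nat.le_succ _) (σgen_sub_e_mem_geW y)) (e_mem_geW y)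

/-- The weight of a word starting with a letter. [folklore] -/
theorem ω_of_mul (y : EGen g) (w : FreeMonoid (EGen g)) : ω g (FreeMonoid.of y * w) = wtE g y + ω g w := by
  simp [ω]

/-- `σ` of a word has at least the weight of the word. [folklore] -/
theorem lift_σgen_mem_geW (w : FreeMonoid (EGen g)) : FreeMonoid.lift (σgen g N) w ∈ geW g (ω g w) := by
  induction w using FreeMonoid.inductionOn' with
  | one => rw [map_one]; exact mem_geW_zero _
  | mul_of y w ih =>
    rw [map_mul, FreeMonoid.lift_eval_of, ω_of_mul]
    exact mul_mem_geW (σgen_mem_geW y) ih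

/-- `σ(word) - word` has weight strictly above the word. [folklore] -/
theorem lift_σgen_sub_single_mem_geW (w : FreeMonoid (EGen g)) :
    FreeMonoid.lift (σgen g N) w - single w 1 ∈ geW g (ω g w + 1) := by
  induction w using FreeMonoid.inductionOn' with
  | one => rw [map_one, ← MonoidAlgebra.one_def, sub_self]; exact zero_mem _
  | mul_of y w ih =>
    rw [map_mul, FreeMonoid.lift_eval_of, ω_of_mul]
    have hs : (single (FreeMonoid.of y * w) 1 : T g) = e g y * single w 1 := by
      rw [e, MonoidAlgebra.single_mul_single, mul_one]
    have : σgen g N y * FreeMonoid.lift (σgen g N) w - single (FreeMonoid.of y * w) 1 =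
        (σgen g N y - e g y) * FreeMonoid.lift (σgen g N) w + e g y * (FreeMonoid.lift (σgen g N) w - single w 1) := by
      rw [hs]; noncomm_ring
    rw [this]
    refine add_mem ?_ ?_
    · have := mul_mem_geW (σgen_sub_e_mem_geW (N := N) y) (lift_σgen_mem_geW (N := N) w)
      exact geW_antitone (by omega) this
    · have := mul_mem_geW (e_mem_geW (g := g) y) ih
      exact geW_antitone (by omega) this

/-- **`σ` preserves the weight filtration.** [folklore] -/
theorem σT_mem_geW {n : ℕ} {a : T g} (ha : a ∈ geW g n) : σT g N a ∈ geW g n := by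
  have h : (geW g n).map (σT g N).toLinearMap ≤ geW g n := by
    change (MonoidAlgebra.supported ℤ ℤ {w | n ≤ ω g w}).map (σT g N).toLinearMap ≤ geW g n
    rw [MonoidAlgebra.supported_eq_span_single, Submodule.map_span, Submodule.span_le]
    rintro _ ⟨_, ⟨w, hw, rfl⟩, rfl⟩
    change σT g N (single w 1) ∈ geW g n
    rw [σT_single, one_smul]
    exact geW_antitone hw (lift_σgen_mem_geW w)
  exact h ⟨a, ha, rfl⟩

/-- **`σ` is unipotent with respect to the weight**: `σ u - u ∈ geW (n+1)` for `u` of pure weight `n`.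
[folklore] -/
theorem σT_sub_self_mem_geW {n : ℕ} {a : T g} (ha : a ∈ tensorGrade ℤ (wtE g) n) : σT g N a - a ∈ geW g (n + 1) := by
  have h : (tensorGrade ℤ (wtE g) n).map ((σT g N).toLinearMap - LinearMap.id) ≤ geW g (n + 1) := by
    change (MonoidAlgebra.supported ℤ ℤ {w | (wordWeight (wtE g) w).toAdd = n}).map
      ((σT g N).toLinearMap - LinearMap.id) ≤ geW g (n + 1)
    rw [MonoidAlgebra.supported_eq_span_single, Submodule.map_span, Submodule.span_le]
    rintro _ ⟨_, ⟨w, hw, rfl⟩, rfl⟩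
    change σT g N (single w 1) - single w 1 ∈ geW g (n + 1)
    rw [σT_single, one_smul]
    have hw' : ω g w = n := hw
    rw [← hw']
    exact lift_σgen_sub_single_mem_geW w
  exact h ⟨a, ha, rfl⟩

/-- `σ` maps heavy elements to heavy elements, so truncation commutes with it up to truncation:
`trunc (σ (trunc v)) = trunc (σ v)`. [folklore] -/
theorem trunc_σT_trunc (v : T g) : trunc g N (σT g N (trunc g N v)) = trunc g N (σT g N v) := by
  have h : σT g N v = σT g N (trunc g N v) + σT g N (v - trunc g N v) := by rw [← map_add, add_sub_cancel]
  rw [h, trunc_add_of_mem_geW_succ _ (σT_mem_geW (sub_trunc_mem_geW v))]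

/-! ## The twist as an operator on `M` and its semilinearity -/

variable (g N)

/-- The operator `Σ = trunc ∘ σ` on `M` (the action of the generator `b₀`). [folklore] -/
def Sig : Module.End ℤ (M g N) := truncM g N ∘ₗ (σT g N).toLinearMap ∘ₗ (light g N).subtype

variable {g N}

/-- `Σ x = trunc (σ x)`. [folklore] -/
@[simp] theorem coe_Sig (x : M g N) : (Sig g N x : T g) = trunc g N (σT g N x) := rfl

/-- **Semilinearity of the twist**: `Σ ∘ Lop u = Lop (σ u) ∘ Σ`. [folklore] -/
theorem Sig_mul_Lop (u : T g) : Sig g N * Lop g N u = Lop g N (σT g N u) * Sig g N := by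
  refine LinearMap.ext fun x => Subtype.ext ?_
  change trunc g N (σT g N (trunc g N (u * x))) = trunc g N (σT g N u * trunc g N (σT g N x))
  rw [trunc_σT_trunc, trunc_mul_trunc, map_mul]

/-- `Σ 1 = 1` (since `σ 1 = 1`). [folklore] -/
theorem Sig_oneM : Sig g N (oneM : M g N) = oneM := by
  refine Subtype.ext ?_
  change trunc g N (σT g N 1) = 1
  rw [map_one, trunc_of_mem_light one_mem_light]

end SurfaceMagnus

end Literature.Algebra.Lie
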